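import Literature.NumberTheory.EllipticCurves.TwoIsogenyShaTwoTorsionEqPhi
import Literature.NumberTheory.EllipticCurves.Curve8x121NontrivialSha
import Literature.NumberTheory.EllipticCurves.Curve6137TwoIsogenyDescent
import HarnessLib

/-!
# `Ш(X₁₂₁/ℚ)[2] ≅ (ℤ/2ℤ)²` exactly for the rank-`1` isogeny-door carrier `X₁₂₁ = [0, 8, 0, 121, 0]`
# (Silverman, AEC, Thm. X.4.2(a); the exact sequence `0 → Ш[φ] → Ш[2] → Ш'[φ̂]`)

Topic `NumberTheory/EllipticCurves`. Companion of `TwoIsogenyShaTwoTorsionExamples` (ranks `0`, `2`, and `E₁₇`) for the rank-`1` row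
`X₁₂₁ = [0, 8, 0, 121, 0]` of route ShaPrimaryTransfer's isogeny-door table (`Curve8x121*`: `rank = 1`, `t_2 = 0`, `#Ш(X₁₂₁)[φ] = 4`).
The dual side is trivial: for `X'₁₂₁ = [0, −16, 0, −420, 0]`, `(X')' = [0, 32, 0, 1936, 0]` and `S(32, 1936) ⊆ {1}` (the classes
`±2, ±11, ±22, −1` die modulo `5`, `9`, `49`), so `2^{dim₂ S(32,1936)} = #α·#(Ш(X') ∩ im Ξ)` forces `Ш(X'₁₂₁) ∩ im Ξ = ⊥`, and
`TwoIsogenyShaTwoTorsionEqPhi` gives `Ш(X₁₂₁)[2] = Ш(X₁₂₁) ∩ im Ξ`: **`#Ш(X₁₂₁/ℚ)[2] = 4`** at rank `1`. Theorems only.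

## References

* [SilvermanAEC2009] J. H. Silverman, *AEC*, 2nd ed.: Thm. X.4.2(a), Example X.4.10, proof of Prop. X.6.2(c), Prop. X.6.5(b).
-/

noncomputable section

open scoped Classical

namespace Literature.NumberTheory.EllipticCurves

namespace Curve8x121

open _root_.WeierstrassCurve _root_.WeierstrassCurve.Affine

/-! ## The dual-side Selmer bound `S(32, 1936) ⊆ {1}` -/

/-- `S(32, 1936)` does not contain: `d = 2, -2, 22, -22` modulo `5`; `d = -1, 11` modulo `9`; `d = -11` modulo `49` (no solution of either chart modulo the stated prime power).
[cite: SilvermanAEC2009, Example X.4.10 (the congruence method)] -/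
theorem not_mem_S_X121dual :
    (-1 : ℤ) ∉ twoIsogenySelmerGroup (32) (1936) ∧
      (2 : ℤ) ∉ twoIsogenySelmerGroup (32) (1936) ∧
      (-2 : ℤ) ∉ twoIsogenySelmerGroup (32) (1936) ∧
      (11 : ℤ) ∉ twoIsogenySelmerGroup (32) (1936) ∧
      (-11 : ℤ) ∉ twoIsogenySelmerGroup (32) (1936) ∧
      (22 : ℤ) ∉ twoIsogenySelmerGroup (32) (1936) ∧
      (-22 : ℤ) ∉ twoIsogenySelmerGroup (32) (1936) := by
  have hB : (1936 : ℤ) ≠ 0 := by norm_num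
  haveI : Fact (Nat.Prime 3) := ⟨by norm_num⟩
  haveI : Fact (Nat.Prime 5) := ⟨by norm_num⟩
  haveI : Fact (Nat.Prime 7) := ⟨by norm_num⟩
  refine ⟨?_, ?_, ?_, ?_, ?_, ?_, ?_⟩
  · refine Carrier6137.not_mem_twoIsogenySelmerGroup_of_not_isSoluble hB 3 ?_
    rw [show (1936 : ℤ) / -1 = -1936 by norm_num]
    exact Carrier6137.not_isSoluble_padic_twoIsogenyQuartic_of_zmodPow 2 (by decide)
  · refine Carrier6137.not_mem_twoIsogenySelmerGroup_of_not_isSoluble hB 5 ?_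
    rw [show (1936 : ℤ) / 2 = 968 by norm_num]
    exact Carrier6137.not_isSoluble_padic_twoIsogenyQuartic_of_zmodPow 1 (by decide)
  · refine Carrier6137.not_mem_twoIsogenySelmerGroup_of_not_isSoluble hB 5 ?_
    rw [show (1936 : ℤ) / -2 = -968 by norm_num]
    exact Carrier6137.not_isSoluble_padic_twoIsogenyQuartic_of_zmodPow 1 (by decide)
  · refine Carrier6137.not_mem_twoIsogenySelmerGroup_of_not_isSoluble hB 3 ?_
    rw [show (1936 : ℤ) / 11 = 176 by norm_num]
    exact Carrier6137.not_isSoluble_padic_twoIsogenyQuartic_of_zmodPow 2 (by decide)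
  · refine Carrier6137.not_mem_twoIsogenySelmerGroup_of_not_isSoluble hB 7 ?_
    rw [show (1936 : ℤ) / -11 = -176 by norm_num]
    exact Carrier6137.not_isSoluble_padic_twoIsogenyQuartic_of_zmodPow 2 (by decide +kernel)
  · refine Carrier6137.not_mem_twoIsogenySelmerGroup_of_not_isSoluble hB 5 ?_
    rw [show (1936 : ℤ) / 22 = 88 by norm_num]
    exact Carrier6137.not_isSoluble_padic_twoIsogenyQuartic_of_zmodPow 1 (by decide)
  · refine Carrier6137.not_mem_twoIsogenySelmerGroup_of_not_isSoluble hB 5 ?_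
    rw [show (1936 : ℤ) / -22 = -88 by norm_num]
    exact Carrier6137.not_isSoluble_padic_twoIsogenyQuartic_of_zmodPow 1 (by decide)

/-- A squarefree integer dividing `1936` is `±` a divisor of `22`. [cite: SilvermanAEC2009, Prop. X.4.9] -/
private theorem mem_of_dvd_1936 {d : ℤ} (hsq : Squarefree d) (hd : d ∣ (1936 : ℤ)) :
    d ∈ ({1, -1, 2, -2, 11, -11, 22, -22} : Finset ℤ) := by
  have hrad : d ∣ 22 := by
    have h5 : d ∣ (22 : ℤ) ^ 4 := dvd_trans hd ⟨121, by norm_num⟩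
    exact (hsq.dvd_pow_iff_dvd (by norm_num)).mp h5
  have h1 : d.natAbs ∣ 22 := by
    have := Int.natAbs_dvd_natAbs.mpr hrad
    simpa using this
  have h2 : d.natAbs ∈ Nat.divisors 22 := Nat.mem_divisors.mpr ⟨h1, by norm_num⟩
  rw [show Nat.divisors 22 = {1, 2, 11, 22} by decide] at h2
  simp only [Finset.mem_insert, Finset.mem_singleton] at h2 ⊢
  rcases Int.natAbs_eq d with h | h <;> rw [h] <;>
    rcases h2 with h2 | h2 | h2 | h2 <;> simp [h2]

/-- **`S(32, 1936) ⊆ {1}`** (only the class of `O`). [cite: SilvermanAEC2009, Prop. X.4.9 and Example X.4.10] -/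
theorem subset_S_X121dual :
    twoIsogenySelmerGroup (32) (1936) ⊆ ({1} : Finset ℤ) := by
  intro d hd
  obtain ⟨hsq, hdvd, -⟩ := (mem_twoIsogenySelmerGroup_iff (a := 32) (by norm_num : (1936 : ℤ) ≠ 0)).mp hd
  have hmem := mem_of_dvd_1936 hsq hdvd
  obtain ⟨hm1, h2, hm2, h11, hm11, h22, hm22⟩ := not_mem_S_X121dual
  simp only [Finset.mem_insert, Finset.mem_singleton] at hmem ⊢
  rcases hmem with rfl | rfl | rfl | rfl | rfl | rfl | rfl | rfl
  · simp
  · exact absurd hd hm1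
  · exact absurd hd h2
  · exact absurd hd hm2
  · exact absurd hd h11
  · exact absurd hd hm11
  · exact absurd hd h22
  · exact absurd hd hm22


/-! ## `Ш(X'₁₂₁)[φ̂] = 0` and `#Ш(X₁₂₁/ℚ)[2] = 4` -/

/-- **`Ш(X'₁₂₁) ∩ im Ξ = ⊥`** for `X'₁₂₁ = X₁₂₁.twoIsogenyCodomain = [0,−16,0,−420,0]`: `2^{dim₂ S(32,1936)} = #α·#(Ш(X') ∩ im Ξ)` with
`S(32,1936) ⊆ {1}`. [cite: SilvermanAEC2009, Thm. X.4.2(a) with Example X.4.10] -/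
theorem sha_inf_range_dual_eq_bot [(⟨0, 8, 0, 121, 0⟩ : WeierstrassCurve ℚ).IsElliptic] :
    (⟨0, 8, 0, 121, 0⟩ : WeierstrassCurve ℚ).twoIsogenyCodomain.sha ⊓
      (⟨0, 8, 0, 121, 0⟩ : WeierstrassCurve ℚ).twoIsogenyCodomain.twoIsogenyTorsorHom.range = ⊥ := by
  have hV : (⟨0, 8, 0, 121, 0⟩ : WeierstrassCurve ℚ).twoIsogenyCodomain.twoIsogenyCodomain =
      ⟨0, ((32 : ℤ) : ℚ), 0, ((1936 : ℤ) : ℚ), 0⟩ := by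
    ext <;> norm_num [twoIsogenyCodomain]
  have hab : (1936 : ℤ) * ((32 : ℤ) ^ 2 - 4 * 1936) ≠ 0 := by norm_num
  have key := two_pow_twoIsogenySelmerRank_eq_natCard_mul hab _ hV
  have hs : 2 ^ twoIsogenySelmerRank 32 1936 ≤ 1 := by
    rw [two_pow_twoIsogenySelmerRank_eq_card hab]
    exact (Finset.card_le_card subset_S_X121dual).trans (by decide)
  haveI hE'' : (⟨0, ((32 : ℤ) : ℚ), 0, ((1936 : ℤ) : ℚ), 0⟩ : WeierstrassCurve ℚ).IsElliptic := isElliptic_mk_of_ne_zero hab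
  have hα : 1 ≤ Nat.card (Set.range (⟨0, ((32 : ℤ) : ℚ), 0, ((1936 : ℤ) : ℚ), 0⟩ : WeierstrassCurve ℚ).xSqClass) := by
    haveI := (natCard_range_xSqClass_le (a := 32) (b := 1936) hab).1.to_subtype
    exact Nat.card_pos
  have hpos : 0 < 2 ^ twoIsogenySelmerRank 32 1936 := pow_pos (by norm_num) _
  set N := Nat.card ↥((⟨0, 8, 0, 121, 0⟩ : WeierstrassCurve ℚ).twoIsogenyCodomain.sha ⊓
      (⟨0, 8, 0, 121, 0⟩ : WeierstrassCurve ℚ).twoIsogenyCodomain.twoIsogenyTorsorHom.range) with hN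
  have hN1 : N = 1 := by
    rcases Nat.eq_zero_or_pos N with h0 | hNpos
    · rw [h0, mul_zero] at key; omega
    · rcases Nat.lt_or_ge 1 N with h2 | h1 <;> nlinarith
  exact sha_inf_range_eq_bot_of_natCard_eq_one _ hN1

/-- **`Ш(X₁₂₁/ℚ)[2] ≅ (ℤ/2ℤ)²` at rank `1`**: the `2`-torsion subgroup of `Ш(X₁₂₁/ℚ)`, `X₁₂₁ = [0, 8, 0, 121, 0]` (rank `1`, `t_2 = 0`),
has exactly `4` elements. [cite: SilvermanAEC2009, Prop. X.6.5(b) (the method)] -/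
theorem natCard_sha_inf_torsionBy_two [(⟨0, 8, 0, 121, 0⟩ : WeierstrassCurve ℚ).IsElliptic] :
    Nat.card ↥((⟨0, 8, 0, 121, 0⟩ : WeierstrassCurve ℚ).sha ⊓
      AddSubgroup.torsionBy (⟨0, 8, 0, 121, 0⟩ : WeierstrassCurve ℚ).galH1 2) = 4 := by
  rw [sha_inf_torsionBy_two_eq_sha_inf_range _ sha_inf_range_dual_eq_bot]
  exact natCard_sha_inf_range_eq

/-- **The rank-`1` row in one statement**: `rank X₁₂₁(ℚ) = 1`, `t_2(X₁₂₁) = 0`, `#Ш(X₁₂₁/ℚ)[2] = 4`, `X₁₂₁ ~ Y = x(x − 14)(x − 44)` with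
`Ш(Y/ℚ)[2] = 0`. [cite: SilvermanAEC2009, Prop. X.6.5(b) (the method)] [cite: Greenberg1999LNM, §1 pp. 54–57] -/
theorem rankOne_row [(⟨0, 8, 0, 121, 0⟩ : WeierstrassCurve ℚ).IsElliptic] :
    (⟨0, 8, 0, 121, 0⟩ : WeierstrassCurve ℚ).mordellWeilRank = 1 ∧
      (⟨0, 8, 0, 121, 0⟩ : WeierstrassCurve ℚ).shaCorank 2 = 0 ∧
      Nat.card ↥((⟨0, 8, 0, 121, 0⟩ : WeierstrassCurve ℚ).sha ⊓
        AddSubgroup.torsionBy (⟨0, 8, 0, 121, 0⟩ : WeierstrassCurve ℚ).galH1 2) = 4 ∧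
      IsIsogenous (⟨0, 8, 0, 121, 0⟩ : WeierstrassCurve ℚ) (⟨0, -58, 0, 616, 0⟩ : WeierstrassCurve ℚ) ∧
      (∀ c ∈ (⟨0, -58, 0, 616, 0⟩ : WeierstrassCurve ℚ).sha, 2 • c = 0 → c = 0) :=
  ⟨mordellWeilRank_X, shaCorank_X_two, natCard_sha_inf_torsionBy_two, isIsogenous_X_Y, forall_mem_sha_Y_two_smul_eq_zero⟩

end Curve8x121

end Literature.NumberTheory.EllipticCurves

end
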